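import Mathlib
import Summits.Langlands.Langlands.Theses.PhantomRMYoshida
import Summits.Langlands.Langlands.Theorems.PhantomRMYoshidaStableYoshidaCongruenceResidualLatticeCharpoly
import Summits.Langlands.Langlands.Theorems.PhantomRMYoshidaStableYoshidaCongruenceInvariantSubspaceFinrankTwoBN
import Summits.Langlands.Langlands.Theorems.PhantomRMYoshidaStableYoshidaCongruenceInvariantSubspaceFinrankTwoFrame
import Literature.NumberTheory.GaloisRepresentations.StableLatticeValuationRing
import Literature.NumberTheory.GaloisRepresentations.ResidualRepresentation
import Literature.NumberTheory.GaloisRepresentations.ResidualGaloisRep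
import Literature.NumberTheory.GaloisRepresentations.AbsGaloisGroupCompact
import HarnessLib

/-!
# Route `PhantomRMYoshida`, crux `StableYoshidaCongruence` (stmt-Langlands-13640), line
# `serre-dual-ribet-square`: Stub 3a `stub_invariantSubspaceFinrankTwo` — invariant subspaces of a
# residually `2 + 2` representation are planes

Registered signature, verbatim (skeleton `Cruxes/StableYoshidaCongruence/Lines/serre_dual_ribet_square.lean`,
Stub 3a; lead prover-line-stmt-Langlands-13640-c2-0, 2026-08-16).  Let `ρ₀ : Γ_ℚ → GL₄(ℚ̄_p)` be continuous
whose Frobenius polynomials are, at almost all places, `p`-integral and reduce through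
`red : 𝒪_{ℚ̄_p} → k` (`k` algebraically closed of characteristic `p`, discrete) to
`charpoly σ(Frob_v) · charpoly σ'(Frob_v)` for two IRREDUCIBLE `σ, σ' : Γ_ℚ → GL₂(k)` — i.e.
`ρ₀.HasResidualPair red σ σ'`, definitionally.  Then every `Γ_ℚ`-invariant subspace `W ⊆ ℚ̄_p⁴` other than
`0` and `ℚ̄_p⁴` has dimension `2`.

Proof (Serre, *Abelian ℓ-adic representations* I §1.1, §2.3; Ribet 1976 §2; Curtis–Reiner (30.16)).
(1) The factorisation holds at EVERY `τ ∈ Γ_ℚ` (Chebotarev density + continuity; the sibling line's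
`exists_map_red_charpoly_eq_mul_of_hasResidualPair`).  (2) `Γ_ℚ` is compact, so `ρ₀` stabilises a
`ℤ̄_p`-lattice `P·ℤ̄_p⁴` (`exists_integralModel_of_valuationSubring`, `ℤ̄_p` the non-Noetherian valuation
ring of `ℚ̄_p`); change its basis inside `GL₄(ℤ̄_p)` so that the first `m = dim W` basis vectors lie in `W`
(`exists_GL_adapted_submodule`, part Frame).  (3) In the new basis `Q`, `ρ₂ = Q⁻¹ ρ₀ Q` is integral and
`Q⁻¹W` is the coordinate subspace `⟨e₀, …, e_{m-1}⟩` (it contains these vectors and has dimension `m`: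
`apply_eq_zero_of_mem_of_finrank_le`), so `ρ₂` is block upper triangular.  (4) Reduce modulo
`𝔪 ⊆ ker red` (`red`, re-typed on `ℤ̄_p`): `ρ̄ = red ∘ ρ₂ : Γ_ℚ → GL₄(k)` is block upper triangular with
`charpoly ρ̄(τ) = red(charpoly ρ₂(τ)) = charpoly σ(τ) · charpoly σ'(τ)` (by (1) and `charpoly_integralModel`),
and the first `m` coordinates span a SUBrepresentation of dimension `m`.  (5) By the Brauer–Nesbitt heart
(`finrank_ne_one_of_charpoly_eq_mul`, part BN: a representation with the characteristic polynomials of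
`σ ⊕ σ'`, `σ, σ'` irreducible of dimension `≠ 1`, has no stable line and no stable hyperplane) `m ≠ 1` and
`4 - m ≠ 1`; as `0 < m < 4`, `m = 2`.  No continuity of `ρ̄` is needed.  Everything used is proved in the
tree; no named fact is taken as a hypothesis.
-/

-- `Summit.Langlands.Langlands.…` (summit = sub-problem name, D-0017 layout) trips `dupNamespace` on every decl.
set_option linter.dupNamespace false

noncomputable section

open Literature.NumberTheory.GaloisRepresentations Literature.NumberTheory.Automorphic
open IsDedekindDomain Matrix Polynomial Module
open scoped NumberField
open Summit.Langlands.Langlands.Cruxes.StableYoshidaCongruence.BurkhardtWeddleTwoThreeAnchor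
  (exists_map_red_charpoly_eq_mul_of_hasResidualPair)

namespace Summit.Langlands.Langlands.Cruxes.StableYoshidaCongruence.SerreDualRibetSquare

/-- **Coordinates beyond the dimension vanish.**  If a subspace `S ⊆ Fⁿ` of dimension `≤ m` contains the
first `m` standard vectors, then every vector of `S` is supported on the first `m` coordinates: the
truncation `S → Fᵐ` is onto, hence injective by dimension count, and kills the vector with its first `m`
coordinates removed. [folklore] -/
theorem apply_eq_zero_of_mem_of_finrank_le {F : Type*} [Field F] {n m : ℕ} (hmn : m ≤ n)
    (S : Submodule F (Fin n → F)) (hS : finrank F S ≤ m)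
    (hstd : ∀ j : Fin n, (j : ℕ) < m → (Pi.single j (1 : F) : Fin n → F) ∈ S)
    (x : Fin n → F) (hx : x ∈ S) (i : Fin n) (hi : m ≤ (i : ℕ)) : x i = 0 := by
  classical
  set π : S →ₗ[F] (Fin m → F) := (LinearMap.funLeft F F (Fin.castLE hmn)).comp S.subtype with hπ
  -- `π` is onto
  have hsurj : Function.Surjective π := by
    intro y
    set z : Fin n → F := fun j => if h : (j : ℕ) < m then y ⟨j, h⟩ else 0 with hz
    have hzS : z ∈ S := mem_of_single_mem S (fun j => (j : ℕ) < m) hstd z fun j hj => by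
      simp [hz, hj]
    refine ⟨⟨z, hzS⟩, funext fun j => ?_⟩
    rw [hπ, truncation_apply]
    simp [hz, Fin.castLE]
  -- hence injective
  have hker : LinearMap.ker π = ⊥ := by
    have h1 := LinearMap.finrank_range_add_finrank_ker π
    rw [LinearMap.range_eq_top.mpr hsurj, finrank_top, finrank_fin_fun] at h1
    apply Submodule.finrank_eq_zero.mp
    omega
  -- the truncated vector `x₀` lies in the kernel
  set x₀ : Fin n → F := fun j => if (j : ℕ) < m then 0 else x j with hx₀
  have hx₀S : x₀ ∈ S := by
    have hv : x - x₀ ∈ S := mem_of_single_mem S (fun j => (j : ℕ) < m) hstd (x - x₀) fun j hj => by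
      simp [hx₀, hj]
    have h2 : x₀ = x - (x - x₀) := (sub_sub_cancel x x₀).symm
    rw [h2]
    exact S.sub_mem hx hv
  have hπx₀ : π ⟨x₀, hx₀S⟩ = 0 := by
    funext j
    rw [hπ, truncation_apply]
    simp [hx₀, Fin.castLE]
  have h0 : (⟨x₀, hx₀S⟩ : S) = 0 := by
    rw [← Submodule.mem_bot F, ← hker, LinearMap.mem_ker]
    exact hπx₀
  have h3 : x₀ i = 0 := by
    have := congrArg (fun y : S => (y : Fin n → F) i) h0
    simpa using this
  simpa [hx₀, not_lt.mpr hi] using h3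

/-! ## The stub -/

/-- **Stub 3a (`stub_invariantSubspaceFinrankTwo`) — the registered signature.**  Let
`ρ₀ : Γ_ℚ → GL₄(ℚ̄_p)` be continuous whose Frobenius polynomials are a.e. `p`-integral and reduce through
`red : 𝒪_{ℚ̄_p} → k` to `charpoly σ(Frob_v) · charpoly σ'(Frob_v)` for two IRREDUCIBLE `σ, σ' : Γ_ℚ → GL₂(k)`.
Then every `Γ_ℚ`-invariant subspace `W ⊆ ℚ̄_p⁴` with `W ≠ 0, ℚ̄_p⁴` is a plane: the factorisation holds at
every `τ ∈ Γ_ℚ` (Chebotarev + continuity); a `Γ_ℚ`-stable `ℤ̄_p`-lattice admits a basis whose first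
`m = dim W` vectors span `W`, in which `ρ₀` is integral and block upper triangular; modulo `𝔪 ⊆ ker red`
the first `m` coordinates span a subrepresentation of a representation `Γ_ℚ → GL₄(k)` with the
characteristic polynomials of `σ ⊕ σ'`, so `m ≠ 1, 3` by Brauer–Nesbitt.
[cite: SerreAbelianLadic1968, Ch. I §1.1 Remark 1, §2.3; CurtisReiner1962, (30.16); Ribet1976, §2] -/
theorem stub_invariantSubspaceFinrankTwo :
    ∀ (p : ℕ) [Fact p.Prime] (k : Type) [Field k] [CharP k p] [IsAlgClosed k]
      [TopologicalSpace k] [DiscreteTopology k] (red : Valued.integer (PadicAlgCl p) →+* k)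
      (σ σ' : FramedGaloisRep ℚ k 2) (ρ₀ : FramedGaloisRep ℚ (PadicAlgCl p) 4),
      σ.toGaloisRep.IsIrreducible → σ'.toGaloisRep.IsIrreducible →
      (∀ᶠ v : HeightOneSpectrum (NumberField.RingOfIntegers ℚ) in Filter.cofinite,
          ρ₀.IsUnramifiedAt v ∧ σ.IsUnramifiedAt v ∧ σ'.IsUnramifiedAt v ∧
          ∃ (P : Polynomial (Valued.integer (PadicAlgCl p))) (P₁ P₂ : Polynomial k),
            ρ₀.HasFrobCharpolyAt v (P.map (Valued.integer (PadicAlgCl p)).subtype) ∧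
            σ.HasFrobCharpolyAt v P₁ ∧ σ'.HasFrobCharpolyAt v P₂ ∧ P.map red = P₁ * P₂) →
      ∀ W : Submodule (PadicAlgCl p) (Fin 4 → PadicAlgCl p),
        (∀ g : Field.absoluteGaloisGroup ℚ, ∀ x ∈ W,
          ((ρ₀ g : GL (Fin 4) (PadicAlgCl p)) : Matrix (Fin 4) (Fin 4) (PadicAlgCl p)).mulVec x ∈ W) →
        W ≠ ⊥ → W ≠ ⊤ → Module.finrank (PadicAlgCl p) W = 2 := by
  intro p _ k _ _ _ _ _ red σ σ' ρ₀ hirr hirr' hpair W hW hbot htop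
  classical
  haveI : CompactSpace (Field.absoluteGaloisGroup ℚ) := absoluteGaloisGroup_compactSpace ℚ
  -- ### (0) the dimension `m`, `0 < m < 4`
  set m : ℕ := finrank (PadicAlgCl p) W with hm
  have hm0 : 0 < m := Nat.pos_of_ne_zero fun h => hbot (Submodule.finrank_eq_zero.mp h)
  have hm4 : m < 4 := by
    have h := Submodule.finrank_lt htop
    rwa [finrank_fin_fun] at h
  -- ### (1) the residual factorisation at every `τ ∈ Γ_ℚ`
  have hcp := exists_map_red_charpoly_eq_mul_of_hasResidualPair red
    (show ρ₀.HasResidualPair red σ σ' from hpair)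
  -- ### (2) a stable `ℤ̄_p`-lattice with a basis adapted to `W`
  set O : ValuationSubring (PadicAlgCl p) := padicAlgClIntegers p with hO
  have hOopen : IsOpen (O : Set (PadicAlgCl p)) := Valued.isOpen_valuationSubring _
  obtain ⟨P, ρ₁, hρ₁⟩ := exists_integralModel_of_valuationSubring (O := O) hOopen
    (ρ₀ : FramedGaloisRep ℚ (PadicAlgCl p) 4)
  obtain ⟨A, hA⟩ := exists_GL_adapted_submodule O P W
  obtain ⟨Q, hQ⟩ : ∃ Q : GL (Fin 4) (PadicAlgCl p), Q = P * Matrix.GeneralLinearGroup.map O.subtype A :=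
    ⟨_, rfl⟩
  have hQval : (Q : Matrix (Fin 4) (Fin 4) (PadicAlgCl p)) =
      (P : Matrix (Fin 4) (Fin 4) (PadicAlgCl p)) * (A : Matrix (Fin 4) (Fin 4) O).map O.subtype := by
    rw [hQ]; rfl
  set ρ₂ : Field.absoluteGaloisGroup ℚ →* GL (Fin 4) O := (MulAut.conj A⁻¹).toMonoidHom.comp ρ₁ with hρ₂
  have hρ₂map : ∀ γ, Matrix.GeneralLinearGroup.map O.subtype (ρ₂ γ) = Q⁻¹ * ρ₀ γ * Q := by
    intro γ
    have h1 : ρ₂ γ = A⁻¹ * ρ₁ γ * A := by simp [hρ₂]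
    rw [h1, map_mul, map_mul, map_inv, hρ₁ γ, hQ, _root_.mul_inv_rev]
    simp only [mul_assoc]
  have hentry : ∀ γ (i j : Fin 4),
      ((((ρ₂ γ : GL (Fin 4) O) : Matrix (Fin 4) (Fin 4) O) i j : O) : PadicAlgCl p) =
        ((Q⁻¹ * ρ₀ γ * Q : GL (Fin 4) (PadicAlgCl p)) : Matrix (Fin 4) (Fin 4) (PadicAlgCl p)) i j := by
    intro γ i j
    rw [← hρ₂map γ]
    rfl
  -- ### (3) block upper triangular shape: `W₂ = Q⁻¹ W` is the span of `e₀, …, e_{m-1}`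
  set W₂ : Submodule (PadicAlgCl p) (Fin 4 → PadicAlgCl p) :=
    W.comap (Matrix.toLin' (Q : Matrix (Fin 4) (Fin 4) (PadicAlgCl p))) with hW₂
  have hmem₂ : ∀ x, x ∈ W₂ ↔ (Q : Matrix (Fin 4) (Fin 4) (PadicAlgCl p)) *ᵥ x ∈ W := fun x => by
    rw [hW₂, Submodule.mem_comap, Matrix.toLin'_apply]
  have hfin₂ : finrank (PadicAlgCl p) W₂ = m := finrank_comap_toLin'_units Q W
  have hstd₂ : ∀ j : Fin 4, (j : ℕ) < m → (Pi.single j 1 : Fin 4 → PadicAlgCl p) ∈ W₂ := fun j hj => by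
    rw [hmem₂, hQval]; exact hA j hj
  have hstab₂ : ∀ γ x, x ∈ W₂ →
      ((Q⁻¹ * ρ₀ γ * Q : GL (Fin 4) (PadicAlgCl p)) : Matrix (Fin 4) (Fin 4) (PadicAlgCl p)) *ᵥ x ∈ W₂ := by
    intro γ x hx
    rw [hmem₂, mulVec_mulVec]
    have e : (Q : Matrix (Fin 4) (Fin 4) (PadicAlgCl p)) *
        ((Q⁻¹ * ρ₀ γ * Q : GL (Fin 4) (PadicAlgCl p)) : Matrix (Fin 4) (Fin 4) (PadicAlgCl p)) =
        ((ρ₀ γ : GL (Fin 4) (PadicAlgCl p)) : Matrix (Fin 4) (Fin 4) (PadicAlgCl p)) *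
          (Q : Matrix (Fin 4) (Fin 4) (PadicAlgCl p)) := by
      rw [← Units.val_mul, ← mul_assoc, ← mul_assoc, mul_inv_cancel, one_mul, Units.val_mul]
    rw [e, ← mulVec_mulVec]
    exact hW γ _ ((hmem₂ x).mp hx)
  have hblock : ∀ γ (i j : Fin 4), m ≤ (i : ℕ) → (j : ℕ) < m →
      ((ρ₂ γ : GL (Fin 4) O) : Matrix (Fin 4) (Fin 4) O) i j = 0 := by
    intro γ i j hi hj
    apply Subtype.ext
    rw [hentry]
    have hcol := hstab₂ γ _ (hstd₂ j hj)
    rw [mulVec_single_one] at hcol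
    exact apply_eq_zero_of_mem_of_finrank_le hm4.le W₂ hfin₂.le hstd₂ _ hcol i hi
  -- ### (4) reduction modulo `𝔪 ⊆ ker red` (`red`, re-typed on `O`: the carriers coincide definitionally)
  let redO : O →+* k := red
  have hredO : ∀ x : O, redO x = red x := fun _ => rfl
  set ρb : Field.absoluteGaloisGroup ℚ →* GL (Fin 4) k := (Matrix.GeneralLinearGroup.map redO).comp ρ₂
    with hρb
  have hρbval : ∀ γ (i j : Fin 4), ((ρb γ : GL (Fin 4) k) : Matrix (Fin 4) (Fin 4) k) i j =
      redO (((ρ₂ γ : GL (Fin 4) O) : Matrix (Fin 4) (Fin 4) O) i j) := fun _ _ _ => rfl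
  have hblockb : ∀ γ (i j : Fin 4), m ≤ (i : ℕ) → (j : ℕ) < m →
      ((ρb γ : GL (Fin 4) k) : Matrix (Fin 4) (Fin 4) k) i j = 0 := fun γ i j hi hj => by
    rw [hρbval, hblock γ i j hi hj, map_zero]
  -- the characteristic polynomials of the reduction
  have hcpb : ∀ τ, ((ρb τ : GL (Fin 4) k) : Matrix (Fin 4) (Fin 4) k).charpoly =
      FramedRep.charpoly σ τ * FramedRep.charpoly σ' τ := by
    intro τ
    obtain ⟨Pτ, hPτ, hPτred⟩ := hcp τ
    have h1 : ((ρb τ : GL (Fin 4) k) : Matrix (Fin 4) (Fin 4) k).charpoly =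
        (((ρ₂ τ : GL (Fin 4) O) : Matrix (Fin 4) (Fin 4) O).charpoly).map redO := by
      rw [← Matrix.charpoly_map]
      rfl
    have h2 : (((ρ₂ τ : GL (Fin 4) O) : Matrix (Fin 4) (Fin 4) O).charpoly).map O.subtype =
        FramedRep.charpoly ρ₀ τ := by
      rw [charpoly_integralModel hρ₂map τ]
      rfl
    rw [h1, ← hPτred]
    ext i
    rw [Polynomial.coeff_map, Polynomial.coeff_map, hredO]
    have hc : (((((ρ₂ τ : GL (Fin 4) O) : Matrix (Fin 4) (Fin 4) O).charpoly).coeff i : O) :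
        PadicAlgCl p) = ((Pτ.coeff i : Valued.integer (PadicAlgCl p)) : PadicAlgCl p) := by
      have h := congrArg (fun P : Polynomial (PadicAlgCl p) => P.coeff i) (h2.trans hPτ.symm)
      simp only [Polynomial.coeff_map] at h
      exact h
    exact congrArg red (Subtype.ext hc)
  -- ### (5) the subrepresentation on the first `m` coordinates
  set τb : Representation k (Field.absoluteGaloisGroup ℚ) (Fin 4 → k) := glRepresentation ρb with hτb
  set Wb : Submodule k (Fin 4 → k) :=
    Submodule.span k (Set.range fun j : Fin m => (Pi.single (Fin.castLE hm4.le j) (1 : k) : Fin 4 → k))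
    with hWb
  have hstdb : ∀ j : Fin 4, (j : ℕ) < m → (Pi.single j (1 : k) : Fin 4 → k) ∈ Wb := fun j hj =>
    Submodule.subset_span ⟨⟨j, hj⟩, by ext i; simp [Fin.castLE]⟩
  have hli : LinearIndependent k fun j : Fin m => (Pi.single (Fin.castLE hm4.le j) (1 : k) : Fin 4 → k) := by
    have h := (Pi.basisFun k (Fin 4)).linearIndependent.comp (Fin.castLE hm4.le) (Fin.castLE_injective _)
    convert h using 1
    ext j i
    simp [Pi.basisFun_apply]
  have hfinb : finrank k Wb = m := by
    rw [hWb, finrank_span_eq_card hli, Fintype.card_fin]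
  have hWbinv : ∀ γ, Wb ≤ Wb.comap (τb γ) := by
    intro γ
    rw [hWb, Submodule.span_le]
    rintro _ ⟨j, rfl⟩
    rw [SetLike.mem_coe, Submodule.mem_comap, ← hWb]
    change ((ρb γ : GL (Fin 4) k) : Matrix (Fin 4) (Fin 4) k) *ᵥ Pi.single (Fin.castLE hm4.le j) 1 ∈ Wb
    rw [mulVec_single_one]
    exact mem_of_single_mem Wb (fun i => (i : ℕ) < m) hstdb _ fun i hi =>
      hblockb γ i _ (not_lt.mp hi) (by simp [Fin.castLE])
  -- ### (6) Brauer–Nesbitt: `m ≠ 1` and `4 - m ≠ 1`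
  have hτbcp : ∀ γ, (τb γ).charpoly = (σ.toRepresentation γ).charpoly * (σ'.toRepresentation γ).charpoly := by
    intro γ
    have e0 : (τb γ : (Fin 4 → k) →ₗ[k] (Fin 4 → k)) =
        Matrix.toLin' ((ρb γ : GL (Fin 4) k) : Matrix (Fin 4) (Fin 4) k) := LinearMap.ext fun v => rfl
    have e1 : (σ.toRepresentation γ : (Fin 2 → k) →ₗ[k] (Fin 2 → k)) =
        Matrix.toLin' ((σ γ : GL (Fin 2) k) : Matrix (Fin 2) (Fin 2) k) := LinearMap.ext fun v => rfl
    have e2 : (σ'.toRepresentation γ : (Fin 2 → k) →ₗ[k] (Fin 2 → k)) =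
        Matrix.toLin' ((σ' γ : GL (Fin 2) k) : Matrix (Fin 2) (Fin 2) k) := LinearMap.ext fun v => rfl
    rw [e0, e1, e2, Matrix.charpoly_toLin', Matrix.charpoly_toLin', Matrix.charpoly_toLin', hcpb]
    rfl
  have h2 : finrank k (Fin 2 → k) ≠ 1 := by rw [finrank_fin_fun]; decide
  obtain ⟨hne1, hne3⟩ := finrank_ne_one_of_charpoly_eq_mul τb σ.toRepresentation σ'.toRepresentation
    hirr hirr' h2 h2 hτbcp Wb hWbinv
  have hq : finrank k ((Fin 4 → k) ⧸ Wb) = 4 - m := by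
    have h := Wb.finrank_quotient_add_finrank
    rw [hfinb, finrank_fin_fun] at h
    omega
  rw [hfinb] at hne1
  rw [hq] at hne3
  change m = 2
  omega

end Summit.Langlands.Langlands.Cruxes.StableYoshidaCongruence.SerreDualRibetSquare

end
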